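import Summits.CriticalPhenomena.CardyFormulaZ2.Theorems.CardyComplexConeParafermionToSLESixFamiliesDiamondDartPhaseStair
import Summits.CriticalPhenomena.CardyFormulaZ2.Theorems.CardyComplexConeParafermionToSLESixFamiliesDiamondDartPhaseTurns
import HarnessLib

/-!
# Calibration of the lattice box of a marked diamond against its frame
# (line `potential-darboux-picard-diamond`, S1p `stub_boundaryDartPhase`, part 14)

Crux `ParafermionToSLESixFamilies` (stmt-CriticalPhenomena-11389), line `potential-darboux-picard-diamond`, stub
`stub_boundaryDartPhase` (S1p). The lattice box `X_j ≤ M j` of the lattice points of an open marked diamond (S1c) is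
described abstractly; this file calibrates it against the frame coordinates `(F_k, G_k)` of mesh points (which move by
`δ/√2` per unit of `X_k = xiC k - upC k`, `T_k = xiC k + upC k`): tangential room of `(n + 5) δ/√2` before the end /
after the start of side `k` gives `T_k + n + 2 ≤ M (k+1)` / `-M (k+3) + 3 ≤ T_k - n` (`T_add_le`, `le_T_sub`), normal
room gives the width (`le_X_sub`), a site of the two layers `X_k ≥ M k - 1` of side `k` is within `√2 δ` of the line of
the side (`gam_le_Fk_add`), so that a frame site near a boundary point of side `k` at distance `σ` from its start lies
on the two layers of side `k`, or else on those of the previous side with `σ` small (`layers_of_near`, registered as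
`layers_of_near_side`). Finally the distance from a point to a piece of side `k` is at most its normal offset when its
tangential coordinate is within the piece (`infDist_piece_le`).
-/

noncomputable section

namespace Summit.CriticalPhenomena.CardyFormulaZ2.Cruxes.ParafermionToSLESixFamilies.PotentialDarbouxPicardDiamond

open Set Metric Complex
open Literature.Probability Literature.Probability.LatticeModels Literature.Probability.Percolation
open Literature.Probability.RandomPlanarGeometry

section Calib

variable {D : DobrushinDomain} {c : ℂ} {α β δ : ℝ}
  (hcar : D.carrier = {z | |(dRot c z).re| < α ∧ |(dRot c z).im| < β}) {M : Fin 4 → ℤ}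
  (hbox : ∀ x : Site 2, meshPoint δ x ∈ D.carrier ↔ ∀ j : Fin 4, xiC j x - upC j x ≤ M j) (hδ : 0 < δ) (k : Fin 4)

/-- Tangential shift along the side keeps the normal coordinate. -/
theorem Fk_shift (x : Site 2) (m : ℤ) :
    Fk k (dRot c (meshPoint δ (x + m • cornerUnit k + m • cornerUnit (k + 1)))) = Fk k (dRot c (meshPoint δ x)) := by
  have := Fk_meshPoint_sub c δ k (x + m • cornerUnit k + m • cornerUnit (k + 1)) x
  simp only [xiC_add_smul1, xiC_add_smul0, upC_add_smul1, upC_add_smul0] at this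
  have e : ((xiC k x + m - (upC k x + m) - (xiC k x - upC k x) : ℤ) : ℝ) = 0 := by push_cast; ring
  rw [e, mul_zero] at this
  linarith

/-- Tangential shift along the side moves the tangential coordinate by `2 m δ/√2`. -/
theorem Gk_shift (x : Site 2) (m : ℤ) :
    Gk k (dRot c (meshPoint δ (x + m • cornerUnit k + m • cornerUnit (k + 1)))) = Gk k (dRot c (meshPoint δ x)) + Real.sqrt 2 / 2 * δ * (2 * m) := by
  have := Gk_meshPoint_sub c δ k (x + m • cornerUnit k + m • cornerUnit (k + 1)) x
  simp only [xiC_add_smul1, xiC_add_smul0, upC_add_smul1, upC_add_smul0] at this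
  have e : ((xiC k x + m + (upC k x + m) - (xiC k x + upC k x) : ℤ) : ℝ) = 2 * m := by push_cast; ring
  rw [e] at this
  linarith

/-- Normal shift across the side keeps the tangential coordinate. -/
theorem Gk_nshift (x : Site 2) (m : ℤ) :
    Gk k (dRot c (meshPoint δ (x + m • cornerUnit k + m • cornerUnit (k + 3)))) = Gk k (dRot c (meshPoint δ x)) := by
  have := Gk_meshPoint_sub c δ k (x + m • cornerUnit k + m • cornerUnit (k + 3)) x
  simp only [xiC_add_smul3, xiC_add_smul0, upC_add_smul3, upC_add_smul0] at this
  have e : ((xiC k x + m + (upC k x - m) - (xiC k x + upC k x) : ℤ) : ℝ) = 0 := by push_cast; ring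
  rw [e, mul_zero] at this
  linarith

/-- Normal shift across the side moves the normal coordinate by `2 m δ/√2`. -/
theorem Fk_nshift (x : Site 2) (m : ℤ) :
    Fk k (dRot c (meshPoint δ (x + m • cornerUnit k + m • cornerUnit (k + 3)))) = Fk k (dRot c (meshPoint δ x)) + Real.sqrt 2 / 2 * δ * (2 * m) := by
  have := Fk_meshPoint_sub c δ k (x + m • cornerUnit k + m • cornerUnit (k + 3)) x
  simp only [xiC_add_smul3, xiC_add_smul0, upC_add_smul3, upC_add_smul0] at this
  have e : ((xiC k x + m - (upC k x - m) - (xiC k x - upC k x) : ℤ) : ℝ) = 2 * m := by push_cast; ring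
  rw [e] at this
  linarith

include hcar hbox hδ in
/-- **Tangential room before the end of the side bounds `T_k` from above.** -/
theorem T_add_le {x : Site 2} (hx : meshPoint δ x ∈ D.carrier) (n : ℕ)
    (hG : Real.sqrt 2 / 2 * δ * (n + 5) ≤ gam' α β k - Gk k (dRot c (meshPoint δ x))) : xiC k x + upC k x + n + 2 ≤ M (k + 1) := by
  obtain ⟨h1, h2⟩ := sqrt_two_div_two_mul_bounds hδ
  obtain ⟨hF, hG0⟩ := (mem_carrier_iff_frame hcar k _).1 hx
  rw [abs_lt] at hF hG0
  obtain ⟨m, hm1, hm2⟩ : ∃ m : ℤ, (n : ℤ) + 3 ≤ 2 * m ∧ 2 * m ≤ (n : ℤ) + 4 := ⟨((n : ℤ) + 4) / 2, by omega, by omega⟩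
  have hm0 : (0 : ℝ) ≤ m := by exact_mod_cast (show (0 : ℤ) ≤ m by omega)
  have hm2' : (2 * m : ℝ) ≤ n + 4 := by exact_mod_cast hm2
  have hh : Real.sqrt 2 / 2 * δ * (2 * m) ≤ Real.sqrt 2 / 2 * δ * (n + 4) := mul_le_mul_of_nonneg_left hm2' (by positivity)
  have hh0 : 0 ≤ Real.sqrt 2 / 2 * δ * (2 * m) := by positivity
  have hy : meshPoint δ (x + m • cornerUnit k + m • cornerUnit (k + 1)) ∈ D.carrier := by
    rw [mem_carrier_iff_frame hcar k, Fk_shift, Gk_shift, abs_lt, abs_lt]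
    exact ⟨hF, by linarith, by nlinarith⟩
  have := ((hbox _).1 hy) (k + 1)
  rw [X_succ] at this
  simp only [xiC_add_smul1, xiC_add_smul0, upC_add_smul1, upC_add_smul0] at this
  omega

include hcar hbox hδ in
/-- **Tangential room after the start of the side bounds `T_k` from below.** -/
theorem le_T_sub {x : Site 2} (hx : meshPoint δ x ∈ D.carrier) (n : ℕ)
    (hG : Real.sqrt 2 / 2 * δ * (n + 5) ≤ Gk k (dRot c (meshPoint δ x)) + gam' α β k) : -M (k + 3) + 3 ≤ xiC k x + upC k x - n := by
  obtain ⟨h1, h2⟩ := sqrt_two_div_two_mul_bounds hδ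
  obtain ⟨hF, hG0⟩ := (mem_carrier_iff_frame hcar k _).1 hx
  rw [abs_lt] at hF hG0
  obtain ⟨m, hm1, hm2⟩ : ∃ m : ℤ, (n : ℤ) + 3 ≤ 2 * m ∧ 2 * m ≤ (n : ℤ) + 4 := ⟨((n : ℤ) + 4) / 2, by omega, by omega⟩
  have hm0 : (0 : ℝ) ≤ m := by exact_mod_cast (show (0 : ℤ) ≤ m by omega)
  have hm2' : (2 * m : ℝ) ≤ n + 4 := by exact_mod_cast hm2
  have hh : Real.sqrt 2 / 2 * δ * (2 * m) ≤ Real.sqrt 2 / 2 * δ * (n + 4) := mul_le_mul_of_nonneg_left hm2' (by positivity)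
  have hh0 : 0 ≤ Real.sqrt 2 / 2 * δ * (2 * m) := by positivity
  have hy : meshPoint δ (x + (-m) • cornerUnit k + (-m) • cornerUnit (k + 1)) ∈ D.carrier := by
    rw [mem_carrier_iff_frame hcar k, Fk_shift, Gk_shift, abs_lt, abs_lt]
    push_cast
    exact ⟨hF, by nlinarith, by linarith⟩
  have := ((hbox _).1 hy) (k + 3)
  rw [X_add_three] at this
  simp only [xiC_add_smul1, xiC_add_smul0, upC_add_smul1, upC_add_smul0] at this
  omega

include hcar hbox hδ in
/-- **Normal room behind a site bounds `X_k` from below.** -/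
theorem le_X_sub {x : Site 2} (hx : meshPoint δ x ∈ D.carrier) (n : ℕ)
    (hF : Real.sqrt 2 / 2 * δ * (n + 5) ≤ Fk k (dRot c (meshPoint δ x)) + gam α β k) : -M (k + 2) + 3 ≤ xiC k x - upC k x - n := by
  obtain ⟨h1, h2⟩ := sqrt_two_div_two_mul_bounds hδ
  obtain ⟨hF0, hG⟩ := (mem_carrier_iff_frame hcar k _).1 hx
  rw [abs_lt] at hF0
  obtain ⟨m, hm1, hm2⟩ : ∃ m : ℤ, (n : ℤ) + 3 ≤ 2 * m ∧ 2 * m ≤ (n : ℤ) + 4 := ⟨((n : ℤ) + 4) / 2, by omega, by omega⟩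
  have hm0 : (0 : ℝ) ≤ m := by exact_mod_cast (show (0 : ℤ) ≤ m by omega)
  have hm2' : (2 * m : ℝ) ≤ n + 4 := by exact_mod_cast hm2
  have hh : Real.sqrt 2 / 2 * δ * (2 * m) ≤ Real.sqrt 2 / 2 * δ * (n + 4) := mul_le_mul_of_nonneg_left hm2' (by positivity)
  have hh0 : 0 ≤ Real.sqrt 2 / 2 * δ * (2 * m) := by positivity
  have hy : meshPoint δ (x + (-m) • cornerUnit k + (-m) • cornerUnit (k + 3)) ∈ D.carrier := by
    rw [mem_carrier_iff_frame hcar k, Fk_nshift, Gk_nshift, abs_lt]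
    push_cast
    exact ⟨⟨by nlinarith, by linarith⟩, hG⟩
  have := ((hbox _).1 hy) (k + 2)
  rw [X_add_two] at this
  simp only [xiC_add_smul3, xiC_add_smul0, upC_add_smul3, upC_add_smul0] at this
  omega

include hcar hbox hδ in
/-- **A site of the two layers of side `k` is within `√2 δ` of the line of the side.** -/
theorem gam_le_Fk_add {x : Site 2} (hx : meshPoint δ x ∈ D.carrier) (hX : M k - 1 ≤ xiC k x - upC k x) :
    gam α β k ≤ Fk k (dRot c (meshPoint δ x)) + Real.sqrt 2 / 2 * δ * 2 := by
  obtain ⟨h1, h2⟩ := sqrt_two_div_two_mul_bounds hδ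
  obtain ⟨hF, hG⟩ := (mem_carrier_iff_frame hcar k _).1 hx
  rw [abs_lt] at hF
  by_contra hlt
  push Not at hlt
  have hy : meshPoint δ (x + (1:ℤ) • cornerUnit k + (1:ℤ) • cornerUnit (k + 3)) ∈ D.carrier := by
    rw [mem_carrier_iff_frame hcar k, Fk_nshift, Gk_nshift, abs_lt]
    push_cast
    exact ⟨⟨by linarith, by linarith⟩, hG⟩
  have := ((hbox _).1 hy) k
  simp only [xiC_add_smul3, xiC_add_smul0, upC_add_smul3, upC_add_smul0] at this
  omega

include hcar hbox hδ in
/-- **The layers of a frame site near a boundary point of side `k`**: within `ρ` of the point of side `k` at distance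
`σ` from its start, with `ρ + 2δ < 2 gam_k` and `σ + ρ + 2δ < dLen_k`, a site of the frame (`X_j ≥ M j - 1` for some
`j`) lies on the two layers of side `k`, or on those of side `k + 3` — and then `σ ≤ ρ + 2δ`. -/
theorem layers_of_near {x : Site 2} (hx : meshPoint δ x ∈ D.carrier) (hfr : ∃ j : Fin 4, M j - 1 ≤ xiC j x - upC j x)
    {b : ℂ} {σ ρ : ℝ} (hb : dRot c b = dParam α β k σ) (hρ : dist (meshPoint δ x) b ≤ ρ) (hρ1 : ρ + 2 * δ < 2 * gam α β k)
    (hρ2 : σ + ρ + 2 * δ < dLen α β k) :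
    M k - 1 ≤ xiC k x - upC k x ∨ (M (k + 3) - 1 ≤ xiC (k + 3) x - upC (k + 3) x ∧ σ ≤ ρ + 2 * δ) := by
  obtain ⟨h1, h2⟩ := sqrt_two_div_two_mul_bounds hδ
  obtain ⟨j, hj⟩ := hfr
  have hnear := gam_le_Fk_add hcar hbox hδ j hx hj
  have hdist : ‖dRot c (meshPoint δ x) - dRot c b‖ ≤ ρ := by rwa [← dist_eq_norm, dist_dRot]
  have hFb : Fk k (dRot c b) = gam α β k := by rw [hb, Fk_dParam]
  have hGb : Gk k (dRot c b) = σ - gam' α β k := by rw [hb, Gk_dParam]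
  have hF := abs_Fk_sub_le k (dRot c (meshPoint δ x)) (dRot c b)
  have hG := abs_Gk_sub_le k (dRot c (meshPoint δ x)) (dRot c b)
  rw [abs_le] at hF hG
  have hL := dLen_eq α β k
  obtain ⟨hg1, -, hg2, -, hg3, -⟩ := gam_succ α β k
  obtain ⟨m, rfl⟩ := exists_eq_add k j
  fin_cases m
  · left; simpa using hj
  · exfalso
    simp only [Fin.mk_one] at hnear
    rw [(Fk_succ k _).1, hg1] at hnear
    linarith
  · exfalso
    simp only [Fin.reduceFinMk] at hnear
    rw [(Fk_add_two k _).1, hg2] at hnear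
    have := gam_pos (show 0 < α from ?_) (show 0 < β from ?_) k
    · linarith
    all_goals
      have hm := min_le_gam α β k
      by_contra hle; push Not at hle
      have : min α β ≤ 0 := by first | exact (min_le_left α β).trans hle | exact (min_le_right α β).trans hle
      linarith
  · right
    simp only [Fin.reduceFinMk] at hnear hj
    rw [(Fk_add_three k _).1, hg3] at hnear
    exact ⟨hj, by linarith⟩

end Calib

/-- The norm of a vector with vanishing tangential coordinate is its normal coordinate. -/
theorem norm_eq_abs_Fk {k : Fin 4} {w : ℂ} (hG : Gk k w = 0) : ‖w‖ = |Fk k w| := by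
  have hn : ‖w‖ = Real.sqrt (w.re ^ 2 + w.im ^ 2) := by
    rw [Complex.norm_eq_sqrt_sq_add_sq]
  fin_cases k <;> simp [Fk, Gk] at hG ⊢ <;> rw [hn, hG] <;> simp [Real.sqrt_sq_eq_abs]

/-- **Distance to a piece of side `k`**: a point whose tangential coordinate is strictly within the piece
`[dParam k σ₁, dParam k σ₂]` (in the frame at `c`) is within its normal offset `|F_k - gam_k|` of the piece. -/
theorem infDist_piece_le {c : ℂ} {α β : ℝ} (k : Fin 4) {σ₁ σ₂ : ℝ} {z : ℂ}
    (h1 : σ₁ - gam' α β k < Gk k (dRot c z)) (h2 : Gk k (dRot c z) < σ₂ - gam' α β k) :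
    infDist z (segment ℝ (dRotInv c (dParam α β k σ₁)) (dRotInv c (dParam α β k σ₂))) ≤ |Fk k (dRot c z) - gam α β k| := by
  set w : ℂ := dRotInv c (dParam α β k (Gk k (dRot c z) + gam' α β k)) with hw
  have hwrot : dRot c w = dParam α β k (Gk k (dRot c z) + gam' α β k) := dRot_dRotInv c _
  have hp : dRot c (dRotInv c (dParam α β k σ₁)) = dParam α β k σ₁ := dRot_dRotInv c _
  have hq : dRot c (dRotInv c (dParam α β k σ₂)) = dParam α β k σ₂ := dRot_dRotInv c _
  have hwseg : w ∈ segment ℝ (dRotInv c (dParam α β k σ₁)) (dRotInv c (dParam α β k σ₂)) := by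
    refine openSegment_subset_segment ℝ _ _ (mem_openSegment_of_frame hp hq (a := w) ?_ ?_ ?_)
    · rw [hwrot]; exact Fk_dParam α β k _
    · rw [hwrot, Gk_dParam]; linarith
    · rw [hwrot, Gk_dParam]; linarith
  refine (infDist_le_dist_of_mem hwseg).trans (le_of_eq ?_)
  rw [← dist_dRot c, dist_eq_norm, hwrot]
  have hG : Gk k (dRot c z - dParam α β k (Gk k (dRot c z) + gam' α β k)) = 0 := by rw [Gk_sub, Gk_dParam]; ring
  rw [norm_eq_abs_Fk hG, Fk_sub, Fk_dParam]

/-- **The layers of a frame site near a boundary point** (registered helper of `stub_boundaryDartPhase`). See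
`layers_of_near`. -/
theorem layers_of_near_side : ∀ (D : DobrushinDomain) (c : ℂ) (α β δ : ℝ), D.carrier = {z | |((z - c) * exp (-(Real.pi / 4 : ℝ) * I)).re| < α ∧ |((z - c) * exp (-(Real.pi / 4 : ℝ) * I)).im| < β} → ∀ (M : Fin 4 → ℤ), (∀ x : Site 2, meshPoint δ x ∈ D.carrier ↔ ∀ j : Fin 4, xiC j x - upC j x ≤ M j) → 0 < δ → ∀ (k : Fin 4) (x : Site 2), meshPoint δ x ∈ D.carrier → (∃ j : Fin 4, M j - 1 ≤ xiC j x - upC j x) → ∀ (b : ℂ) (σ ρ : ℝ), dRot c b = dParam α β k σ → dist (meshPoint δ x) b ≤ ρ → ρ + 2 * δ < 2 * gam α β k → σ + ρ + 2 * δ < dLen α β k → M k - 1 ≤ xiC k x - upC k x ∨ (M (k + 3) - 1 ≤ xiC (k + 3) x - upC (k + 3) x ∧ σ ≤ ρ + 2 * δ) := by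
  intro D c α β δ hcar M hbox hδ k x hx hfr b σ ρ hb hρ hρ1 hρ2
  exact layers_of_near hcar hbox hδ k hx hfr hb hρ hρ1 hρ2

end Summit.CriticalPhenomena.CardyFormulaZ2.Cruxes.ParafermionToSLESixFamilies.PotentialDarbouxPicardDiamond

end
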